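import Summits.CriticalPhenomena.Ising3D.IsingColumnFaceL11CensusRadiiJointCore
import Summits.CriticalPhenomena.Ising3D.IsingColumnFaceL11CensusGapsAlg

/-!
# The catalogue census of §7.3 as kernel facts, XV: the covering radius of the WHOLE frozen catalogue on the certified
`Δε` segment — core: `ALG` witness enclosures, the three-way merged window check, constants (cell `pub-ising3x`, seat
recog-1; paper §1.6 / §7.3; DRAWER ITEM of recog-1 gen 57 — built and farm-checked, filing is a later seat's call;
companion of part XIV `…CensusRadiiJoint{Core,A–D,}`)

HONEST FRAMING: lottery ticket; floor = tightest certified 3D Ising CFT bounds; no exact-solution claim without a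
proof. Island framing: certified exclusion region at stated derivative order and assumptions; not a determination of
the 3D Ising critical exponents beyond that.

Part XIV made the JOINT covering radius of the two transcendental tables `LIN ∪ TRG` a kernel fact (`8.751·10⁻⁶`). With the
algebraic table `ALG` (`algFamily d H`, `(d, H) ∈ algTable`) and the three tabulated rational families added, the widest hole of
the WHOLE frozen catalogue on `[81/64, 2855/2048]` is smaller again, `7.254·10⁻⁶`, and sits next to a RATIONAL member: between
`x' = 977/705` (`ALG`, degree `1`) and the `LIN` member `y' = (16 − ζ(3) + 2G)/12`. MACHINE = part XIV's with one more merged list: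
per window the landed `LIN` candidates (`linWin`, units `linU`) sorted, merged with the `TRG` witness enclosures (`witEnc` of part
XIV; here `619` tuples — every `TRG` member inside a `LIN` gap longer than `9/10` of the new gap constant), then merged with the
enclosures `algWitEnc` (this file) of `22` `ALG` WITNESSES — entries `(l, u, c)` accepted by the landed `algEntryOK` of part IV inside
the same kernel evaluation (`20` rationals `p/q` with `p, q ≤ 1024` as point entries; `2` cubic roots bracketed to `10⁻¹²` by an exact
sign change), each enclosing an `ALG` member of a table rung (`algEntryOK_sound`) — and the landed chain `zgapsLE` at the gap constant
`catG = y'.hi − x'.lo` (`201088162057417660 / linU = 7.2542627005·10⁻⁶`; `catCover`, `catCover_part`: one `PartsOK` link for «`linU·v`,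
`v` a value of `ALG ∪ LIN ∪ TRG`»). Hole data: `catHoleA/B` (the window of the `LIN`/`TRG` checkers), `catHoleBA` (upper end of the
`ALG` checker window `[977/705, catHoleBA]`), `catHoleY`, `catHoleYhi`. Witness lists in `…RadiiCatWit.lean`; kernel evaluations in
`…RadiiCat{A,B,C,D}.lean`; theorems in `…RadiiCat.lean`. Exact ℕ-twin (same integers end to end, window verdicts pessimistic w.r.t. tie
order): recog-1 gen 57 `gen57/part2/twin_cat.py`. Pure arithmetic over landed definitions and certified enclosures; no certificate,
no datum, no σ–ε axiom; nothing about `Δε`; nothing is recognised (§1.6); no number of record, no P(M·) relevance.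
lottery ticket; floor = tightest certified 3D Ising CFT bounds; no exact-solution claim without a proof.
-/

namespace Summit.CriticalPhenomena.Ising3D
namespace ColumnFaceL11
open Set Literature.MathematicalPhysics.QuantumFieldTheory.ConformalBootstrap3D

/-! ### The `ALG` witness enclosure in units `linU` -/

/-- The enclosure, in units `linU = 10¹⁸·27720`, of an `ALG` witness entry `(l, u, c)` of the landed `algEntryOK`:
`(⌊linU·l⌋, ⌈linU·u⌉)` as naturals (used only with `0 ≤ l`, checked alongside). [folklore] -/
def algWitEnc (e : ℚ × ℚ × List ℤ) : ℕ × ℕ :=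
  (⌊(linU : ℚ) * e.1⌋.toNat, ⌈(linU : ℚ) * e.2.1⌉.toNat)

/-- The side condition checked on every `ALG` witness inside the kernel evaluation: accepted by `algEntryOK` and `0 ≤ l`.
[folklore] -/
def algWitOK (e : ℚ × ℚ × List ℤ) : Bool := algEntryOK e && decide (0 ≤ e.1)

/-- **Soundness of `algWitEnc`**: for an accepted entry with `0 ≤ l` the enclosure contains `linU·v` for an `ALG` member `v` of a
table rung — a value of the real catalogue `ALG ∪ (LIN ∪ TRG)`. [folklore] -/
theorem algWitEnc_sound {e : ℚ × ℚ × List ℤ} (hok : algWitOK e = true) :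
    ∃ w : ℝ, (∃ v : ℝ, v ∈ {v : ℝ | ∃ dH ∈ algTable, v ∈ algFamily dH.1 dH.2} ∪
        (linFamily 12 ∪ trgFullFamily 17 32) ∧ w = (linU : ℝ) * v) ∧
      (((algWitEnc e).1 : ℕ) : ℝ) ≤ w ∧ w ≤ (((algWitEnc e).2 : ℕ) : ℝ) := by
  unfold algWitOK at hok
  rw [Bool.and_eq_true, decide_eq_true_eq] at hok
  obtain ⟨hok, h0⟩ := hok
  obtain ⟨v, hv, h1, h2⟩ := algEntryOK_sound hok
  have hU0 : (0 : ℝ) ≤ (linU : ℝ) := by positivity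
  have hl : (((linU : ℚ) * e.1 : ℚ) : ℝ) ≤ (linU : ℝ) * v := by
    push_cast; exact mul_le_mul_of_nonneg_left h1 hU0
  have hu : (linU : ℝ) * v ≤ (((linU : ℚ) * e.2.1 : ℚ) : ℝ) := by
    push_cast; exact mul_le_mul_of_nonneg_left h2 hU0
  have hf0 : 0 ≤ ⌊(linU : ℚ) * e.1⌋ := Int.floor_nonneg.mpr (mul_nonneg (by positivity) h0)
  have hfl : (((⌊(linU : ℚ) * e.1⌋ : ℤ) : ℚ) : ℝ) ≤ (((linU : ℚ) * e.1 : ℚ) : ℝ) :=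
    Rat.cast_le.mpr (Int.floor_le _)
  have hce : (((linU : ℚ) * e.2.1 : ℚ) : ℝ) ≤ (((⌈(linU : ℚ) * e.2.1⌉ : ℤ) : ℚ) : ℝ) :=
    Rat.cast_le.mpr (Int.le_ceil _)
  have c1 : ((⌊(linU : ℚ) * e.1⌋.toNat : ℕ) : ℝ) = ((⌊(linU : ℚ) * e.1⌋ : ℤ) : ℝ) := by
    exact_mod_cast Int.toNat_of_nonneg hf0
  have c2 : ((⌈(linU : ℚ) * e.2.1⌉ : ℤ) : ℝ) ≤ ((⌈(linU : ℚ) * e.2.1⌉.toNat : ℕ) : ℝ) := by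
    exact_mod_cast Int.self_le_toNat _
  refine ⟨(linU : ℝ) * v, ⟨v, Set.mem_union_left _ hv, rfl⟩, ?_, ?_⟩
  · simp only [algWitEnc]
    rw [c1]
    push_cast at hl hfl ⊢
    linarith
  · simp only [algWitEnc]
    push_cast at hu hce ⊢
    linarith

/-! ### The three-way merged window check -/

/-- The covering check of one window `(x, hi − g]` for the whole real catalogue: the `TRG` witnesses satisfy
`trgGTupleOK 17 32`, the `ALG` witnesses satisfy `algWitOK`, and the landed chain `zgapsLE g` passes on the sorted `LIN` candidates of
`[x, hi]` merged with the `TRG` witness enclosures, merged with the `ALG` witness enclosures. [folklore] -/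
def catCover (g x hi : ℕ) (W : List TrgTuple) (A : List (ℚ × ℚ × List ℤ)) : Bool :=
  W.all (trgGTupleOK 17 32) && A.all algWitOK &&
    zgapsLE g x (mergeN 10000000 (mergeN 10000000 (msortN (linWin x hi)) (W.map witEnc)) (A.map algWitEnc)) hi

/-- What a passed window check means (one `PartsOK` link for «`linU·v`, `v` a value of `ALG ∪ (LIN ∪ TRG)`»). [folklore] -/
theorem catCover_part {g x x' : ℕ} {W : List TrgTuple} {A : List (ℚ × ℚ × List ℤ)}
    (h : catCover g x (x' + g) W A = true) :
    ∃ Lst : List (ℕ × ℕ), zgapsLE g x Lst (x' + g) = true ∧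
      ∀ e ∈ Lst, ∃ w : ℝ, (∃ v : ℝ, v ∈ {v : ℝ | ∃ dH ∈ algTable, v ∈ algFamily dH.1 dH.2} ∪
          (linFamily 12 ∪ trgFullFamily 17 32) ∧ w = (linU : ℝ) * v) ∧
        ((e.1 : ℕ) : ℝ) ≤ w ∧ w ≤ ((e.2 : ℕ) : ℝ) := by
  unfold catCover at h
  simp only [Bool.and_eq_true] at h
  obtain ⟨⟨hW, hA⟩, hz⟩ := h
  refine ⟨_, hz, fun e he => ?_⟩
  have he' := mem_mergeN _ _ _ e he
  rw [List.mem_append] at he'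
  rcases he' with he1 | he3
  · have he1' := mem_mergeN _ _ _ e he1
    rw [List.mem_append] at he1'
    rcases he1' with heL | heT
    · obtain ⟨w, ⟨v, hv, rfl⟩, h1, h2⟩ := linWin_sound (mem_of_mem_msortN heL)
      exact ⟨_, ⟨v, Set.mem_union_right _ (Set.mem_union_left _ hv), rfl⟩, h1, h2⟩
    · rw [List.mem_map] at heT
      obtain ⟨t, ht, rfl⟩ := heT
      obtain ⟨w, ⟨v, hv, rfl⟩, h1, h2⟩ := witEnc_sound ((List.all_eq_true.mp hW) t ht)
      refine ⟨_, ⟨v, ?_, rfl⟩, h1, h2⟩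
      rcases hv with hv | hv
      · exact Set.mem_union_right _ (Set.mem_union_left _ hv)
      · exact Set.mem_union_right _ (Set.mem_union_right _ hv)
  · rw [List.mem_map] at he3
    obtain ⟨a, ha, rfl⟩ := he3
    exact algWitEnc_sound ((List.all_eq_true.mp hA) a ha)

/-! ### Constants: the gap, the hole windows, the bounding members -/

/-- The gap constant in units `linU`: `y'.hi − x'.lo` in the kernel's own integer enclosures
(`201088162057417660 / linU = 7.2542627005…·10⁻⁶`). [folklore] -/
def catG : ℕ := 201088162057417660

/-- The window of the `LIN` / `TRG` hole checkers: `[1.3858156028, 1.3858228571]`. [folklore] -/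
def catHoleA : ℚ := 13858156028 / 10 ^ 10

/-- See `catHoleA`. [folklore] -/
def catHoleB : ℚ := 13858228571 / 10 ^ 10

/-- Upper end of the `ALG` checker window `[977/705, catHoleBA]` (lower end = the left bounding member itself): `1.385823`, a
six-digit denominator on purpose — the landed `algExcluded` works with integers scaled by `a.den · b.den`, and `705 · 10⁶` instead of
`705 · 10¹⁰` is what keeps the degree-`6` evaluation at seconds (measured: `22 s` vs `> 170 s`); no `ALG` member lies in
`(y', 1.385823]` (twin), so the wider window lists nothing new. [folklore] -/
def catHoleBA : ℚ := 1385823 / 10 ^ 6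

/-- The right bounding member of the widest catalogue hole, a `LIN` tuple: `y' = (16 − ζ(3) + 2G)/12`. [folklore] -/
def catHoleY : ℤ × List ℤ × ℕ := (16, [0, 0, 0, 0, -1, 0, 2], 12)

/-- A sixteen-digit rational upper bound of `y'` (its landed enclosure's upper end, rounded up). [folklore] -/
def catHoleYhi : ℚ := 13858228570995800 / 10 ^ 16

end ColumnFaceL11
end Summit.CriticalPhenomena.Ising3D
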